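import Summits.QuantumFields.YangMills.Theorems.ParabolicTrajectoryLatticeGapOnTrajectoryStubTiltChessboardStepAux

/-!
# Crux `LatticeGapOnTrajectory` (stmt-QuantumFields-10523), line `sparse-defect-orbit-window`:
# stub (B) `stub_tiltChessboardStep` — the one-direction chessboard estimate for exponential
# tilt functionals of one orientation class on the odd four-torus

With `Ψ(e) := E_β exp(-∑ₓ e(x) Re tr ρ(U_{(x,o)}))` for a tilt profile `e` on the sites of
`(ℤ/(2S+1))⁴` and a fixed plane `o`, we prove `Ψ(c)^{2S+1} ≤ ∏ₛ Ψ(x ↦ c(x[0 := s]))` for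
`0 ≤ c ≤ β`, from odd-torus Osterwalder–Seiler positivity with a crossing tilt (hypothesis (A)).

Route: the abstract chessboard estimate on the odd cycle `OddCycle.chessboard` applied to
`σ ↦ Ψ(x ↦ c(x[0 := σ (x 0)]))`; rotation invariance from translation invariance of the Wilson
measure; the reflection Schwarz inequality `Ψ(d)² ≤ Ψ(d⁺) Ψ(d⁻)` from the support file's
`schwarz_profiles` ((A) tested on `a P + b Q`).  For a spatial plane the kept layers
`1 ≤ x₀ ≤ S + 1` are positive spatial plaquettes plus the shared slice (no tilt, the shared slice
split evenly between the two factors); for a temporal plane one first translates time by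
`S + 1 ≡ -S`, after which the kept link layers `1 ≤ y₀ ≤ S` are positive temporal plaquettes and
the crossing layer `y₀ = 0` carries the tilt of (A).
-/

set_option autoImplicit false

noncomputable section

namespace Summit.QuantumFields.YangMills.Cruxes.LatticeGapOnTrajectory.SparseDefectOrbitWindow

open scoped BigOperators ENNReal ComplexOrder ComplexConjugate
open MeasureTheory Literature.MathematicalPhysics.QuantumFieldTheory
open Summit.QuantumFields.QCD.Cruxes.WindowExtinction.ChessboardColdCells

section Schwarz

variable {S N : ℕ} {G : Type} [Group G] [TopologicalSpace G] [IsTopologicalGroup G]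
  [CompactSpace G] [MeasurableSpace G] [BorelSpace G]
variable (ρ : G →* Matrix (Fin N) (Fin N) ℂ) (o : {q : Fin 4 × Fin 4 // q.1 < q.2})

/-- **Reflection Schwarz inequality for a spatial plane** (`o.1.1 ≠ 0`): `Ψ(d)² ≤ Ψ(d⁺) Ψ(d⁻)`
with `d⁺ = d ∘ [x₀ := θ⁺ x₀]`, `d⁻ = d ∘ [x₀ := θ⁻ x₀]` the two half-reflected profiles of the odd
cycle (`OddCycle.plusHalf id`, `OddCycle.minusHalf id`).  The kept layers are `1 ≤ x₀ ≤ S` and the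
shared slice `x₀ = S + 1` (fixed by `t ↦ 1 - t`), whose weight is split evenly. -/
theorem schwarz_spatial
    (hRP : ∀ (d L N : ℕ) [NeZero d] [NeZero L] (G : Type) [Group G] [TopologicalSpace G]
      [IsTopologicalGroup G] [CompactSpace G] [MeasurableSpace G] [BorelSpace G]
      (ρ : G →* Matrix (Fin N) (Fin N) ℂ), Odd L → 3 ≤ L → Continuous ρ →
      ∀ (β : ℝ), 0 ≤ β → ∀ (t : Plaquette d L → ℝ), (∀ p, 0 ≤ t p) → (∀ p, t p ≤ β) →
      ∀ (F : GaugeConfig d L G → ℂ), Measurable F → (∃ C : ℝ, ∀ U, ‖F U‖ ≤ C) →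
        DependsOn F (↑(WilsonOddRP.oPosEdges ∪ WilsonOddRP.oSharedEdges : Finset (Edge d L))) →
        0 ≤ wilsonExpectation ρ β (fun U : GaugeConfig d L G =>
          (starRingEnd ℂ) (F U.timeReflect) * F U *
            ((Real.exp (-∑ p ∈ Finset.univ.filter WilsonOddRP.IsOCrossPlaq,
                t p * WilsonRP.plaqRe ρ U p) : ℝ) : ℂ)))
    (hS : 1 ≤ S) (hρ : Continuous ρ) {β : ℝ} (hβ : 0 ≤ β) (hi : o.1.1 ≠ 0)
    (dd : Site 4 (2 * S + 1) → ℝ) :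
    (∫ U, Real.exp (-∑ x, dd x * WilsonRP.plaqRe ρ U (x, o))
        ∂(wilsonMeasure ρ β : Measure (GaugeConfig 4 (2 * S + 1) G))) ^ 2 ≤
      (∫ U, Real.exp (-∑ x, dd (Function.update x 0 (OddCycle.plusHalf id (x 0))) *
          WilsonRP.plaqRe ρ U (x, o)) ∂(wilsonMeasure ρ β : Measure (GaugeConfig 4 (2 * S + 1) G))) *
      (∫ U, Real.exp (-∑ x, dd (Function.update x 0 (OddCycle.minusHalf id (x 0))) *
          WilsonRP.plaqRe ρ U (x, o)) ∂(wilsonMeasure ρ β : Measure (GaugeConfig 4 (2 * S + 1) G))) := by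
  -- the site part of the reflection for a spatial plane: `x ↦ θ x`
  have hr : ∀ x : Site 4 (2 * S + 1), (WilsonRP.plaqReflect (x, o)).1 = x.timeReflect := fun x => by
    simp [WilsonRP.plaqReflect, hi]
  have htr : ∀ x : Site 4 (2 * S + 1), Function.update x 0 (1 - x 0) = x.timeReflect := fun _ => rfl
  have hv : ∀ x : Site 4 (2 * S + 1), ((x.timeReflect 0).val = 1 - (x 0).val ∧ (x 0).val ≤ 1) ∨
      ((x.timeReflect 0).val = 1 + (2 * S + 1) - (x 0).val ∧ 1 < (x 0).val) := fun x => by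
    have h := OddCycle.val_one_sub hS (x 0)
    rw [WilsonRP.timeReflect_apply_zero]
    split_ifs at h with h1
    · exact Or.inl ⟨h, h1⟩
    · exact Or.inr ⟨h, lt_of_not_ge h1⟩
  have hfix : ∀ x : Site 4 (2 * S + 1), (x 0).val = S + 1 → x.timeReflect = x := fun x hx =>
    WilsonOddRP.timeReflect_of_val_eq (odd_two_mul_add_one S) (by rw [hx]; omega)
  -- the two half observables (shared slice split evenly) and no crossing tilt
  set eP : Site 4 (2 * S + 1) → ℝ := fun x =>
    if 1 ≤ (x 0).val ∧ (x 0).val ≤ S then dd x else if (x 0).val = S + 1 then dd x / 2 else 0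
    with heP
  set eQ : Site 4 (2 * S + 1) → ℝ := fun x =>
    if 1 ≤ (x 0).val ∧ (x 0).val ≤ S then dd x.timeReflect else
      if (x 0).val = S + 1 then dd x / 2 else 0
    with heQ
  set w : Site 4 (2 * S + 1) → ℝ := fun _ => 0 with hw
  have key := schwarz_profiles ρ o hRP hS hρ hβ eP eQ w
    (fun x hx => by
      simp only [heP] at hx
      split_ifs at hx with h1 h2
      · exact Or.inl h1
      · exact Or.inr ⟨hi, h2⟩
      · exact absurd rfl hx)
    (fun x hx => by
      simp only [heQ] at hx
      split_ifs at hx with h1 h2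
      · exact Or.inl h1
      · exact Or.inr ⟨hi, h2⟩
      · exact absurd rfl hx)
    (fun x hx => absurd rfl hx) (fun _ => le_rfl) (fun _ => hβ)
  -- identification of the three profiles
  have h1 : ∀ x, eQ (WilsonRP.plaqReflect (x, o)).1 + eP x + w x = dd x := by
    intro x
    have hvx := hv x
    have hlt := ZMod.val_lt (x 0)
    have hlt' := ZMod.val_lt (x.timeReflect 0)
    rw [hr]
    simp only [heP, heQ, hw, WilsonRP.timeReflect_timeReflect, add_zero]
    split_ifs <;>
      first
      | (exfalso; omega)
      | (simp only [hfix x ‹(x 0).val = S + 1›]; ring)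
      | ring
  have h2 : ∀ x, eP (WilsonRP.plaqReflect (x, o)).1 + eP x + w x =
      dd (Function.update x 0 (OddCycle.plusHalf id (x 0))) := by
    intro x
    have hvx := hv x
    have hlt := ZMod.val_lt (x 0)
    have hlt' := ZMod.val_lt (x.timeReflect 0)
    rw [hr]
    simp only [heP, hw, OddCycle.plusHalf, OddCycle.mem_cPlus, id, add_zero]
    split_ifs <;>
      first
      | (exfalso; omega)
      | (simp only [hfix x ‹(x 0).val = S + 1›, Function.update_eq_self]; ring)
      | (simp only [Function.update_eq_self, htr]; ring)
  have h3 : ∀ x, eQ (WilsonRP.plaqReflect (x, o)).1 + eQ x + w x =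
      dd (Function.update x 0 (OddCycle.minusHalf id (x 0))) := by
    intro x
    have hvx := hv x
    have hlt := ZMod.val_lt (x 0)
    have hlt' := ZMod.val_lt (x.timeReflect 0)
    rw [hr]
    simp only [heQ, hw, OddCycle.minusHalf, OddCycle.mem_cMinus, id, add_zero,
      WilsonRP.timeReflect_timeReflect]
    split_ifs <;>
      first
      | (exfalso; omega)
      | (simp only [hfix x ‹(x 0).val = S + 1›, Function.update_eq_self]; ring)
      | (simp only [Function.update_eq_self, htr]; ring)
  simp only [h1, h2, h3] at key
  exact key

/-- **Reflection Schwarz inequality for a temporal plane** (`o.1.1 = 0`): `Ψ(d)² ≤ Ψ(d⁺) Ψ(d⁻)`.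
After translating time by `-S ≡ S + 1` the kept link layers are `1 ≤ y₀ ≤ S` (positive temporal
plaquettes, ending on the shared slice), the crossing layer `y₀ = 0` carries the tilt of (A), and
the reflection acts on link layers by `t ↦ -t`. -/
theorem schwarz_temporal
    (hRP : ∀ (d L N : ℕ) [NeZero d] [NeZero L] (G : Type) [Group G] [TopologicalSpace G]
      [IsTopologicalGroup G] [CompactSpace G] [MeasurableSpace G] [BorelSpace G]
      (ρ : G →* Matrix (Fin N) (Fin N) ℂ), Odd L → 3 ≤ L → Continuous ρ →
      ∀ (β : ℝ), 0 ≤ β → ∀ (t : Plaquette d L → ℝ), (∀ p, 0 ≤ t p) → (∀ p, t p ≤ β) →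
      ∀ (F : GaugeConfig d L G → ℂ), Measurable F → (∃ C : ℝ, ∀ U, ‖F U‖ ≤ C) →
        DependsOn F (↑(WilsonOddRP.oPosEdges ∪ WilsonOddRP.oSharedEdges : Finset (Edge d L))) →
        0 ≤ wilsonExpectation ρ β (fun U : GaugeConfig d L G =>
          (starRingEnd ℂ) (F U.timeReflect) * F U *
            ((Real.exp (-∑ p ∈ Finset.univ.filter WilsonOddRP.IsOCrossPlaq,
                t p * WilsonRP.plaqRe ρ U p) : ℝ) : ℂ)))
    (hS : 1 ≤ S) (hρ : Continuous ρ) {β : ℝ} (hβ : 0 ≤ β) (hi : o.1.1 = 0)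
    (dd : Site 4 (2 * S + 1) → ℝ) (hd0 : ∀ x, 0 ≤ dd x) (hdβ : ∀ x, dd x ≤ β) :
    (∫ U, Real.exp (-∑ x, dd x * WilsonRP.plaqRe ρ U (x, o))
        ∂(wilsonMeasure ρ β : Measure (GaugeConfig 4 (2 * S + 1) G))) ^ 2 ≤
      (∫ U, Real.exp (-∑ x, dd (Function.update x 0 (OddCycle.plusHalf id (x 0))) *
          WilsonRP.plaqRe ρ U (x, o)) ∂(wilsonMeasure ρ β : Measure (GaugeConfig 4 (2 * S + 1) G))) *
      (∫ U, Real.exp (-∑ x, dd (Function.update x 0 (OddCycle.minusHalf id (x 0))) *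
          WilsonRP.plaqRe ρ U (x, o)) ∂(wilsonMeasure ρ β : Measure (GaugeConfig 4 (2 * S + 1) G))) := by
  haveI : Fact (1 < 2 * S + 1) := ⟨by omega⟩
  -- the site part of the reflection for a temporal plane: time `t ↦ -t`
  have hr : ∀ x : Site 4 (2 * S + 1), (WilsonRP.plaqReflect (x, o)).1 = (x.shift 0).timeReflect :=
    fun x => by simp [WilsonRP.plaqReflect, hi]
  have hr0 : ∀ x : Site 4 (2 * S + 1), (x.shift 0).timeReflect 0 = -x 0 := fun x => by
    rw [WilsonRP.timeReflect_apply_zero, WilsonRP.shift_apply_self]; ring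
  have hrk : ∀ (x : Site 4 (2 * S + 1)) (k : Fin 4), k ≠ 0 → (x.shift 0).timeReflect k = x k :=
    fun x k hk => by rw [WilsonRP.timeReflect_apply_of_ne _ hk, WilsonRP.shift_apply_of_ne _ hk]
  have hv : ∀ x : Site 4 (2 * S + 1), (((x.shift 0).timeReflect 0).val = 0 ∧ (x 0).val = 0) ∨
      (((x.shift 0).timeReflect 0).val = (2 * S + 1) - (x 0).val ∧ 0 < (x 0).val) := fun x => by
    have h := WilsonRP.val_timeReflect_shift_zero x
    split_ifs at h with h0
    · exact Or.inl ⟨h, h0⟩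
    · exact Or.inr ⟨h, Nat.pos_of_ne_zero h0⟩
  -- translation by `-S e₀`
  set u : Site 4 (2 * S + 1) := Pi.single 0 (-((S : ℕ) : ZMod (2 * S + 1))) with hu
  have hu0 : ∀ y : Site 4 (2 * S + 1), (y + u) 0 = y 0 - (S : ℕ) := fun y => by
    simp [hu, sub_eq_add_neg]
  have huk : ∀ (y : Site 4 (2 * S + 1)) (k : Fin 4), k ≠ 0 → (y + u) k = y k := fun y k hk => by
    simp [hu, hk]
  have hvu : ∀ y : Site 4 (2 * S + 1), (((y + u) 0).val = (y 0).val - S ∧ S ≤ (y 0).val) ∨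
      (((y + u) 0).val = (y 0).val + (2 * S + 1) - S ∧ (y 0).val < S) := fun y => by
    have h := OddCycle.val_sub_natCast (show S < 2 * S + 1 by omega) (y 0)
    rw [hu0]
    split_ifs at h with h1
    · exact Or.inl ⟨h, h1⟩
    · exact Or.inr ⟨h, lt_of_not_ge h1⟩
  have hL : (2 : ZMod (2 * S + 1)) * ((S : ℕ) : ZMod (2 * S + 1)) + 1 = 0 := by
    have h := ZMod.natCast_self (2 * S + 1)
    push_cast at h
    exact h
  have hsite : ∀ y : Site 4 (2 * S + 1),
      Function.update (y + u) 0 (1 - (y + u) 0) = (y.shift 0).timeReflect + u := by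
    intro y
    funext k
    by_cases hk : k = 0
    · subst hk
      simp only [Function.update_self, Pi.add_apply, hr0, hu, Pi.single_eq_same]
      linear_combination hL
    · simp only [Function.update_of_ne hk, Pi.add_apply, hrk y k hk]
  -- the two half observables and the crossing tilt, for the translated profile `y ↦ dd (y + u)`
  set eP : Site 4 (2 * S + 1) → ℝ := fun y =>
    if 1 ≤ (y 0).val ∧ (y 0).val ≤ S then dd (y + u) else 0 with heP
  set eQ : Site 4 (2 * S + 1) → ℝ := fun y =>
    if 1 ≤ (y 0).val ∧ (y 0).val ≤ S then dd ((y.shift 0).timeReflect + u) else 0 with heQ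
  set w : Site 4 (2 * S + 1) → ℝ := fun y => if (y 0).val = 0 then dd (y + u) else 0 with hw
  have key := schwarz_profiles ρ o hRP hS hρ hβ eP eQ w
    (fun x hx => by
      simp only [heP] at hx
      split_ifs at hx with h1
      · exact Or.inl h1
      · exact absurd rfl hx)
    (fun x hx => by
      simp only [heQ] at hx
      split_ifs at hx with h1
      · exact Or.inl h1
      · exact absurd rfl hx)
    (fun x hx => by
      simp only [hw] at hx
      split_ifs at hx with h1
      · exact ⟨hi, h1⟩
      · exact absurd rfl hx)
    (fun x => by
      simp only [hw]
      split_ifs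
      · exact hd0 _
      · exact le_rfl)
    (fun x => by
      simp only [hw]
      split_ifs
      · exact hdβ _
      · exact hβ)
  -- identification of the three profiles (as translates)
  have h1 : ∀ y, eQ (WilsonRP.plaqReflect (y, o)).1 + eP y + w y = dd (y + u) := by
    intro y
    have hvy := hv y
    have hlt := ZMod.val_lt (y 0)
    rw [hr]
    simp only [heP, heQ, hw, WilsonRP.timeReflect_shift_timeReflect_shift]
    split_ifs <;> first | (exfalso; omega) | ring
  have h2 : ∀ y, eP (WilsonRP.plaqReflect (y, o)).1 + eP y + w y =
      dd (Function.update (y + u) 0 (OddCycle.minusHalf id ((y + u) 0))) := by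
    intro y
    have hvy := hv y
    have hvuy := hvu y
    have hlt := ZMod.val_lt (y 0)
    rw [hr]
    simp only [heP, hw, OddCycle.minusHalf, OddCycle.mem_cMinus, id]
    split_ifs <;>
      first
      | (exfalso; omega)
      | (simp only [Function.update_eq_self, hsite]; ring)
  have h3 : ∀ y, eQ (WilsonRP.plaqReflect (y, o)).1 + eQ y + w y =
      dd (Function.update (y + u) 0 (OddCycle.plusHalf id ((y + u) 0))) := by
    intro y
    have hvy := hv y
    have hvuy := hvu y
    have hlt := ZMod.val_lt (y 0)
    rw [hr]
    simp only [heQ, hw, OddCycle.plusHalf, OddCycle.mem_cPlus, id,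
      WilsonRP.timeReflect_shift_timeReflect_shift]
    split_ifs <;>
      first
      | (exfalso; omega)
      | (simp only [Function.update_eq_self, hsite]; ring)
  simp only [h1, h2, h3] at key
  -- undo the translation
  have E0 := integral_exp_sum_shift ρ o β dd u
  have E1 := integral_exp_sum_shift ρ o β
    (fun x => dd (Function.update x 0 (OddCycle.minusHalf id (x 0)))) u
  have E2 := integral_exp_sum_shift ρ o β
    (fun x => dd (Function.update x 0 (OddCycle.plusHalf id (x 0)))) u
  beta_reduce at E1 E2
  rw [E0, E1, E2] at key
  exact key.trans_eq (mul_comm _ _)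

end Schwarz

/-! ## The stub -/

/-- **(B) One-direction chessboard for tilt functionals of one orientation class on the odd
four-torus**, from odd-torus reflection positivity with a crossing tilt (A)
(Fröhlich–Israel–Lieb–Simon maximisation argument on the odd cycle, in the time direction).
With `Φ(c) := E_β exp(-∑ₓ c(x) Re tr ρ(U_{(x,o)}))` for a tilt profile `0 ≤ c ≤ β` on the sites of
`(ℤ/(2S+1))⁴` and a fixed plane `o`: `Φ(c)^{2S+1} ≤ ∏ₛ Φ(x ↦ c(x[0 := s]))`. -/
theorem stub_tiltChessboardStep :
    (∀ (d L N : ℕ) [NeZero d] [NeZero L] (G : Type) [Group G] [TopologicalSpace G]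
      [IsTopologicalGroup G] [CompactSpace G] [MeasurableSpace G] [BorelSpace G]
      (ρ : G →* Matrix (Fin N) (Fin N) ℂ), Odd L → 3 ≤ L → Continuous ρ →
      ∀ (β : ℝ), 0 ≤ β → ∀ (t : Plaquette d L → ℝ), (∀ p, 0 ≤ t p) → (∀ p, t p ≤ β) →
      ∀ (F : GaugeConfig d L G → ℂ), Measurable F → (∃ C : ℝ, ∀ U, ‖F U‖ ≤ C) →
        DependsOn F (↑(WilsonOddRP.oPosEdges ∪ WilsonOddRP.oSharedEdges : Finset (Edge d L))) →
        0 ≤ wilsonExpectation ρ β (fun U : GaugeConfig d L G =>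
          (starRingEnd ℂ) (F U.timeReflect) * F U *
            ((Real.exp (-∑ p ∈ Finset.univ.filter WilsonOddRP.IsOCrossPlaq,
                t p * WilsonRP.plaqRe ρ U p) : ℝ) : ℂ))) →
    ∀ (S N : ℕ) (G : Type) [Group G] [TopologicalSpace G] [IsTopologicalGroup G] [CompactSpace G]
      [MeasurableSpace G] [BorelSpace G] (ρ : G →* Matrix (Fin N) (Fin N) ℂ), 1 ≤ S → Continuous ρ →
    ∀ (β : ℝ), 0 ≤ β → ∀ (o : {q : Fin 4 × Fin 4 // q.1 < q.2}) (c : Site 4 (2 * S + 1) → ℝ),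
      (∀ x, 0 ≤ c x) → (∀ x, c x ≤ β) →
      (∫ U, Real.exp (-∑ x : Site 4 (2 * S + 1), c x * WilsonRP.plaqRe ρ U (x, o))
          ∂(wilsonMeasure ρ β : Measure (GaugeConfig 4 (2 * S + 1) G))) ^ (2 * S + 1) ≤
        ∏ s : ZMod (2 * S + 1),
          ∫ U, Real.exp (-∑ x : Site 4 (2 * S + 1),
              c (Function.update x 0 s) * WilsonRP.plaqRe ρ U (x, o))
            ∂(wilsonMeasure ρ β : Measure (GaugeConfig 4 (2 * S + 1) G)) := by
  intro hRP S N G _ _ _ _ _ _ ρ hS hρ β hβ o c hc0 hcβ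
  -- the functional of re-indexed profiles
  set Φ : (ZMod (2 * S + 1) → ZMod (2 * S + 1)) → ℝ := fun τ =>
    ∫ U, Real.exp (-∑ x : Site 4 (2 * S + 1), c (Function.update x 0 (τ (x 0))) *
      WilsonRP.plaqRe ρ U (x, o)) ∂(wilsonMeasure ρ β : Measure (GaugeConfig 4 (2 * S + 1) G))
    with hΦ
  have h0 : ∀ τ, 0 ≤ Φ τ := fun τ => integral_nonneg fun U => (Real.exp_pos _).le
  -- rotation invariance (translation invariance of the Wilson measure)
  have hrot : ∀ (τ : ZMod (2 * S + 1) → ZMod (2 * S + 1)) (a : ZMod (2 * S + 1)),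
      Φ (fun t => τ (t + a)) = Φ τ := by
    intro τ a
    simp only [hΦ]
    have h := integral_exp_sum_shift ρ o β (fun x => c (Function.update x 0 (τ (x 0))))
      (Pi.single 0 a)
    beta_reduce at h
    have hpt : ∀ x : Site 4 (2 * S + 1),
        Function.update (x + Pi.single 0 a : Site 4 (2 * S + 1)) 0
          (τ ((x + Pi.single 0 a : Site 4 (2 * S + 1)) 0)) = Function.update x 0 (τ (x 0 + a)) := by
      intro x
      funext k
      by_cases hk : k = 0
      · subst hk
        simp
      · simp [hk]
    simp only [hpt] at h
    exact h
  -- the reflection Schwarz inequality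
  have hsch : ∀ τ : ZMod (2 * S + 1) → ZMod (2 * S + 1),
      Φ τ ^ 2 ≤ Φ (OddCycle.plusHalf τ) * Φ (OddCycle.minusHalf τ) := by
    intro τ
    simp only [hΦ]
    have hp : ∀ x : Site 4 (2 * S + 1),
        Function.update (Function.update x 0 (OddCycle.plusHalf id (x 0))) 0
          (τ (Function.update x 0 (OddCycle.plusHalf id (x 0)) 0)) =
        Function.update x 0 (OddCycle.plusHalf τ (x 0)) := by
      intro x
      rw [Function.update_idem, Function.update_self]
      congr 1
      simp only [OddCycle.plusHalf]
      split_ifs <;> rfl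
    have hm : ∀ x : Site 4 (2 * S + 1),
        Function.update (Function.update x 0 (OddCycle.minusHalf id (x 0))) 0
          (τ (Function.update x 0 (OddCycle.minusHalf id (x 0)) 0)) =
        Function.update x 0 (OddCycle.minusHalf τ (x 0)) := by
      intro x
      rw [Function.update_idem, Function.update_self]
      congr 1
      simp only [OddCycle.minusHalf]
      split_ifs <;> rfl
    by_cases hi : o.1.1 = 0
    · have h := schwarz_temporal ρ o hRP hS hρ hβ hi (fun x => c (Function.update x 0 (τ (x 0))))
        (fun x => hc0 _) (fun x => hcβ _)
      beta_reduce at h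
      simp only [hp, hm] at h
      exact h
    · have h := schwarz_spatial ρ o hRP hS hρ hβ hi (fun x => c (Function.update x 0 (τ (x 0))))
      beta_reduce at h
      simp only [hp, hm] at h
      exact h
  have key := OddCycle.chessboard hS Φ h0 hrot hsch id
  simp only [hΦ, id_eq, Function.update_eq_self] at key
  exact key

end Summit.QuantumFields.YangMills.Cruxes.LatticeGapOnTrajectory.SparseDefectOrbitWindow

end
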